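/-
Copyright: the b2b-balaban T⁴-continuum CRUX team, row NE7b OWNER lineage `t4-ne7b-p1` (gen 126). Project licence.
-/
import Summits.QuantumFields.BalabanUV.T4Continuum.Spine.NE7b.SupZdPerturbedCovarianceSymmetric
import Summits.QuantumFields.BalabanUV.T4Continuum.Spine.NE7b.SupZdKernelForm
import Summits.QuantumFields.BalabanUV.T4Continuum.Spine.NE7b.SupBackgroundSemigroup

/-!
# THE FORM OF `H_V + K` IS COERCIVE ON `ℤ^d`, AND THE FLUCTUATION COVARIANCE IS POSITIVE: for every mesh `n`, coupling `a`, potential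
# `V ≥ −λ` (bounded), kernel `|K(p,q)| ≤ εe^{−γ|p−q|₁}` (NO symmetry needed) and every `w` with an exponential block profile,
# `(min(2,a) − λ − εK_γ)·Σ′_pw(p)² ≤ Σ′_pw(p)·((H_V + K)w)(p)` (absolutely convergent) — `B6QGQLower276.coercive_AX` on finite supports, the
# potential's floor, a Schur bound on the kernel form, and (233)'s extension from finite supports to localised functions; hence for ANY
# fluctuation part `w_f = C_Kf` with (221)'s displays, `(min(2,a) − λ − εK_γ)·Σ′(C_Kf)² ≤ Σ′_p(C_Kf)(p)f(p) = ⟨f, C_Kf⟩`: under the road's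
# smallness `λ + εK_γ ≤ min(2,a)` THE COVARIANCE OF THE PERTURBED ROAD IS POSITIVE, `⟨f, C_Kf⟩ ≥ 0`, with the quantitative gain
# `⟨f, C_Kf⟩ ≥ γ_K‖C_Kf‖₂²` (row NE7b, node U5c; (231)∕(233)∕(256) + `coercive_AX` BY NAME; [folklore])

Cell `pub-balaban`, sub-cell `t4`, spine estimate NE7b (`T4WeightBudget.RelWeightBound`; the cell's OWN estimate — NOT PRINTED in
[Bałaban 1983–89], NOT PROVED).  Crux-route work under `Spine/NE7b/` by the row OWNER (`t4-ne7b-p1` gen 126, file (257)) under FREEZE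
(0)'s crux-prover clause, on (256)'s located item («Positivity `⟨f, C_Kf⟩ = ⟨(H+K)C_Kf, C_Kf⟩ ≥ 0` needs the form coercivity of `H_V + K` on
`ℤ^d` for profile functions — recorded, not typed here»); NOTHING of Bałaban's is named as a Lean object, valued or asserted; no
`T4Continuum/Support` leaf typed; no `def`, no notation (the fluctuation part and its coarse remainder are ANY data with the displayed
properties — (221)∕(222)∕(246) supply them); zero `sorry`.  Imports (BY NAME): the OWNER's (256) `…SupZdPerturbedCovarianceSymmetric`
(`fine_sum_blocks_zero`; through it (231) `summable_of_blockProfile`, (189) `finset_sum_exp_l1_le` ∕ `summable_kernel_row`, (191)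
`natAbs_sub_comm_sum`, (179) `abs_le_side_mul`), (233) `…SupZdKernelForm` (`floor_of_decay` — the cube exhaustion of `ℤ^d`), (108′)
`…SupBackgroundSemigroup` (`sum_nbhd_AX_mul` — the row formula of `Δ^η + aQ′*Q′`); the Literature columns `B6QGQLower276` (`AX`, `blk`, `B`,
`chart`, `blk_chart`, `abs_AX_le`, `c0`, **`coercive_AX`** — `min(2,a)·Σ_Sw² ≤ Σ_Sw·Σ_SA(p,q)w` on every finite `S`), `B5Hk103ScalarZd`
(`nbhd`, `tsum_AX_mul`); Mathlib's `dist_le_pi_dist`, `Int.dist_eq`, `tsum_eq_single`, `summable_of_ne_finset_zero`.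

WHY (located).  (256) proved the road's fluctuation covariance `C_K` SYMMETRIC on `ℤ^d` and recorded that POSITIVITY `⟨f, C_Kf⟩ ≥ 0` needs one
more input: with `w = C_Kf`, (221)'s displays give `f = (H_V + K)w + c_f∘blk` and `Q′w = 0`, so `⟨f, w⟩ = ⟨(H_V + K)w, w⟩ + ⟨c_f∘blk, w⟩ =
⟨w, (H_V + K)w⟩ + 0` ((256) §1), and what is missing is a FLOOR of the form `⟨w, (H_V + K)w⟩` for functions of block profile on the infinite
lattice.  On finite supports the floor is three lines: `B6QGQLower276.coercive_AX` (`Δ^η + aQ′*Q′ ≥ min(2,a)`, block by block — Poincaré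
inside the block plus the block-mean term), `V ≥ −λ` on the diagonal, and the Schur bound `|Σ_pΣ_q g(p)K(p,q)g(q)| ≤ εK_γΣg²` (`|g(p)g(q)| ≤
(g(p)² + g(q)²)∕2`, row AND column sums of the symmetric majorant `εe^{−γ|p−q|₁}` by (189) — no symmetry of `K`).  The passage to the
infinite lattice is (233)'s `floor_of_decay` for the ONE kernel `T = A + Vδ + K` (entries `≤ (c₀ + B_V + ε)e^{−δ_T|p−q|₁}`, `δ_T =
min(γ, (d+1)⁻¹)`, since `|A(p,q)| ≤ c₀e^{−dist(p,q)}` and `|p−q|₁ ≤ d·dist`) and the SITE profile `|w(p)| ≤ Ae^{μd}e^{−(μ∕(n+1))|p − p₀|₁}` that a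
BLOCK profile `Ae^{−μ|blk n p − b|₁}` implies (`|p − q|₁ ≤ (n+1)(|blk p − blk q|₁ + d)`); the row `Σ′_qT(p,q)w(q)` IS the displayed action
`(n+1)²Σ_μ(2w(p) − w(p±e_μ)) + a(n+1)^{−d}Σ_{B(blk p)}w + V(p)w(p) + Σ′_qK(p,q)w(q)` (`sum_nbhd_AX_mul`).  All constants introduced for the
passage (`c₀`, `δ_T`, `e^{μd}`, `μ∕(n+1)`) serve absolute convergence only and do not enter the floor `γ_K := min(2,a) − λ − εK_γ`, which is
mesh-free and volume-free.

WHAT IS PROVED ([folklore]):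
* §1 **`kernel_form_le`** (Schur: `|Σ_{p∈S}g(p)Σ_{q∈S}K(p,q)g(q)| ≤ εK_γΣ_Sg²`), **`perturbed_form_floor_finite`** (for every finite `S` and every
  `g`: `γ_K·Σ_Sg² ≤ Σ_{p∈S}g(p)Σ_{q∈S}(A(p,q) + V(p)δ_{pq} + K(p,q))g(q)`).
* §2 `l1_le_blockDist` (`|p − q|₁ ≤ (n+1)(|blk n p − blk n q|₁ + d)`), `siteProfile_of_blockProfile`, `l1_le_dist` (`|p−q|₁ ≤ d·dist(p,q)`),
  `perturbed_kernel_decay` (`|A + Vδ + K| ≤ (c₀ + B_V + ε)e^{−δ_T|p−q|₁}`), **`perturbed_row_eq`** (the row of `A + Vδ + K` on a bounded `w` is the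
  displayed action, summable), **`perturbed_form_floor_profile`** (THE FLOOR for block-profile `w`: `Σ′w²` and `Σ′w·(H_V+K)w` converge and
  `γ_K·Σ′w² ≤ Σ′_pw(p)·((H_V + K)w)(p)`).
* §3 THE END **`perturbed_covariance_floor`** (for ANY `w_f`, `c_f` with (221)'s displays of `C_Kf` and a bounded `f`: `Σ′w_ff` converges and
  `γ_K·Σ′w_f² ≤ Σ′_pw_f(p)f(p)`) and **`perturbed_covariance_nonneg`** (`λ + εK_γ ≤ min(2,a)` ⟹ `0 ≤ Σ′_p(C_Kf)(p)f(p)`).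
* §4 toy.

HONEST (what this is NOT).  Positivity of the PAIRING `⟨f, C_Kf⟩` for bounded `f` against profile fluctuation parts, with the quantitative
floor `γ_K‖C_Kf‖₂²`; NOT an `ℓ²` operator statement (no density ∕ Lax–Milgram packaging), not the spectral gap of `C_K` from above (that is
(253)'s sup bound), constants as displayed and not sharp (`min(2,a)` is `B6QGQLower276`'s); scalar skeleton ((A3), NC-NE7b-α UNRULED);
nothing of the torus; nothing of the covariant propagators of [B4]–[B6]; nothing of Bałaban's asserted.  BY-NAME EFFECT ON THE WALL: NONE.
NE7b NOT PRINTED ∕ NOT PROVED; spine PROVED 0∕9; rung (B)+1 — the programme's measures remain FINITE-torus statements; NOT the mass gap, NOT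
Clay.  HONEST DEPENDENCY: continuum YM on T⁴ ⇐ BetaPertH ∧ nine spine estimates (0∕9 proved); BetaPertH ⇐ (D1) ∧ (D4) ∧ CAP+tail; G-an2-4
gates asym, D1 and NE2∕3∕4.
-/

set_option autoImplicit false

noncomputable section

namespace Summit.QuantumFields.BalabanUV.T4Continuum.NE7b.SupZdPerturbedFormCoercive

open Real Filter Topology
open Literature.MathematicalPhysics.QuantumFieldTheory.Balaban1983to89
open B6QGQLower276 (X e blk B side chart mem_B blk_chart AX c0 abs_AX_le coercive_AX)
open B5Hk103ScalarZd (nbhd tsum_AX_mul AX_eq_zero_of_not_mem)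
open SupZdExponentialSums (finset_sum_exp_l1_le summable_kernel_row)
open SupZdCoarseForm (natAbs_sub_comm_sum)
open SupTorusTowerComparison (abs_le_side_mul)
open SupZdGreenIdentity (summable_of_blockProfile)
open SupZdKernelForm (floor_of_decay)
open SupBackgroundSemigroup (sum_nbhd_AX_mul)
open SupZdPerturbedCovarianceSymmetric (fine_sum_blocks_zero)

variable {d : ℕ}

/-! ## §1. The floor on finite supports: `coercive_AX`, the potential, and a Schur bound on the kernel form -/

/-- **SCHUR BOUND ON THE KERNEL FORM**: `|K(p,q)| ≤ εe^{−γ|p−q|₁}` ⟹ for every finite `S` and every `g`,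
`|Σ_{p∈S}g(p)Σ_{q∈S}K(p,q)g(q)| ≤ εK_γΣ_{p∈S}g(p)²`, `K_γ = (2∕(1−e^{−γ}))^d` — `|g(p)g(q)| ≤ (g(p)² + g(q)²)∕2` and the row and column sums of
the symmetric majorant ((189) `finset_sum_exp_l1_le`); no symmetry of `K` is used. [folklore] -/
theorem kernel_form_le {ε γ : ℝ} (hε : 0 ≤ ε) (hγ : 0 < γ) (K : X d → X d → ℝ)
    (hK : ∀ p q, |K p q| ≤ ε * exp (-(γ * ∑ i, (((p i - q i).natAbs : ℕ) : ℝ)))) (S : Finset (X d)) (g : X d → ℝ) :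
    |∑ p ∈ S, g p * ∑ q ∈ S, K p q * g q| ≤ ε * (2 * (1 - exp (-γ))⁻¹) ^ d * ∑ p ∈ S, g p ^ 2 := by
  classical
  obtain ⟨E, hE⟩ : ∃ E : X d → X d → ℝ, ∀ p q, E p q = exp (-(γ * ∑ i, (((p i - q i).natAbs : ℕ) : ℝ))) :=
    ⟨_, fun _ _ => rfl⟩
  have hE0 : ∀ p q, 0 ≤ E p q := fun p q => by rw [hE]; exact (exp_pos _).le
  have hEs : ∀ p q, E p q = E q p := fun p q => by rw [hE, hE, natAbs_sub_comm_sum]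
  have hrow : ∀ p, ∑ q ∈ S, E p q ≤ (2 * (1 - exp (-γ))⁻¹) ^ d := fun p => by
    simp only [hE]; exact finset_sum_exp_l1_le hγ p S
  have hterm : ∀ p q, |g p * (K p q * g q)| ≤ (ε / 2 * g p ^ 2) * E p q + (ε / 2 * g q ^ 2) * E p q := by
    intro p q
    rw [abs_mul, abs_mul]
    have h2 : |g p| * |g q| ≤ (g p ^ 2 + g q ^ 2) / 2 := by
      nlinarith [sq_nonneg (|g p| - |g q|), sq_abs (g p), sq_abs (g q)]
    have hKE : |K p q| ≤ ε * E p q := by rw [hE]; exact hK p q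
    calc |g p| * (|K p q| * |g q|) = |K p q| * (|g p| * |g q|) := by ring
      _ ≤ ε * E p q * ((g p ^ 2 + g q ^ 2) / 2) :=
          mul_le_mul hKE h2 (mul_nonneg (abs_nonneg _) (abs_nonneg _)) (mul_nonneg hε (hE0 p q))
      _ = _ := by ring
  have hB1 : ∑ p ∈ S, (ε / 2 * g p ^ 2) * ∑ q ∈ S, E p q ≤ ∑ p ∈ S, (ε / 2 * g p ^ 2) * (2 * (1 - exp (-γ))⁻¹) ^ d :=
    Finset.sum_le_sum fun p _ => mul_le_mul_of_nonneg_left (hrow p) (by positivity)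
  have hB2 : ∑ q ∈ S, (ε / 2 * g q ^ 2) * ∑ p ∈ S, E p q ≤ ∑ q ∈ S, (ε / 2 * g q ^ 2) * (2 * (1 - exp (-γ))⁻¹) ^ d :=
    Finset.sum_le_sum fun q _ => by
      rw [Finset.sum_congr rfl fun p _ => hEs p q]
      exact mul_le_mul_of_nonneg_left (hrow q) (by positivity)
  calc |∑ p ∈ S, g p * ∑ q ∈ S, K p q * g q| = |∑ p ∈ S, ∑ q ∈ S, g p * (K p q * g q)| := by
        simp only [Finset.mul_sum]
    _ ≤ ∑ p ∈ S, ∑ q ∈ S, |g p * (K p q * g q)| :=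
        (Finset.abs_sum_le_sum_abs _ _).trans (Finset.sum_le_sum fun p _ => Finset.abs_sum_le_sum_abs _ _)
    _ ≤ ∑ p ∈ S, ∑ q ∈ S, ((ε / 2 * g p ^ 2) * E p q + (ε / 2 * g q ^ 2) * E p q) :=
        Finset.sum_le_sum fun p _ => Finset.sum_le_sum fun q _ => hterm p q
    _ = ∑ p ∈ S, (ε / 2 * g p ^ 2) * ∑ q ∈ S, E p q + ∑ q ∈ S, (ε / 2 * g q ^ 2) * ∑ p ∈ S, E p q := by
        simp only [Finset.sum_add_distrib, Finset.mul_sum]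
        congr 1
        exact Finset.sum_comm
    _ ≤ ∑ p ∈ S, (ε / 2 * g p ^ 2) * (2 * (1 - exp (-γ))⁻¹) ^ d + ∑ q ∈ S, (ε / 2 * g q ^ 2) * (2 * (1 - exp (-γ))⁻¹) ^ d :=
        add_le_add hB1 hB2
    _ = ε * (2 * (1 - exp (-γ))⁻¹) ^ d * ∑ p ∈ S, g p ^ 2 := by
        rw [← Finset.sum_mul, ← Finset.mul_sum]; ring

/-- **THE FLOOR OF `H_V + K` ON FINITE SUPPORTS**: for every mesh `n`, coupling `a`, potential `V ≥ −λ`, kernel `|K(p,q)| ≤ εe^{−γ|p−q|₁}`,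
every finite `S ⊂ ℤ^d` and every `g`: `(min(2,a) − λ − εK_γ)·Σ_{p∈S}g(p)² ≤ Σ_{p∈S}g(p)·Σ_{q∈S}(A(p,q) + V(p)δ_{pq} + K(p,q))g(q)` —
`coercive_AX` for `A = Δ^η + aQ′*Q′`, the diagonal floor, §1's Schur bound. [folklore] -/
theorem perturbed_form_floor_finite (n : ℕ) (a : ℝ) {lam ε γ : ℝ} (hε : 0 ≤ ε) (hγ : 0 < γ) (V : X d → ℝ) (hV : ∀ p, -lam ≤ V p)
    (K : X d → X d → ℝ) (hK : ∀ p q, |K p q| ≤ ε * exp (-(γ * ∑ i, (((p i - q i).natAbs : ℕ) : ℝ))))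
    (S : Finset (X d)) (g : X d → ℝ) :
    (min 2 a - lam - ε * (2 * (1 - exp (-γ))⁻¹) ^ d) * ∑ p ∈ S, g p ^ 2
      ≤ ∑ p ∈ S, g p * ∑ q ∈ S, (AX n a p q + (if p = q then V p else 0) + K p q) * g q := by
  classical
  have hA := coercive_AX n a S g
  have hKf := kernel_form_le hε hγ K hK S g
  have hD : ∑ p ∈ S, g p * ∑ q ∈ S, (if p = q then V p else 0) * g q = ∑ p ∈ S, V p * g p ^ 2 := by
    refine Finset.sum_congr rfl fun p hp => ?_
    simp only [ite_mul, zero_mul, Finset.sum_ite_eq, if_pos hp]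
    ring
  have hDV : -lam * ∑ p ∈ S, g p ^ 2 ≤ ∑ p ∈ S, V p * g p ^ 2 := by
    rw [Finset.mul_sum]
    exact Finset.sum_le_sum fun p _ => mul_le_mul_of_nonneg_right (hV p) (sq_nonneg _)
  have hsplit : ∑ p ∈ S, g p * ∑ q ∈ S, (AX n a p q + (if p = q then V p else 0) + K p q) * g q
      = ∑ p ∈ S, g p * ∑ q ∈ S, AX n a p q * g q + ∑ p ∈ S, g p * ∑ q ∈ S, (if p = q then V p else 0) * g q
        + ∑ p ∈ S, g p * ∑ q ∈ S, K p q * g q := by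
    simp only [add_mul, Finset.sum_add_distrib, mul_add]
  rw [hsplit, hD]
  have hK' := neg_abs_le (∑ p ∈ S, g p * ∑ q ∈ S, K p q * g q)
  nlinarith [hA, hKf, hDV, hK']

/-! ## §2. From finite supports to functions of block profile on the infinite lattice -/

/-- **FINE DISTANCES UNDER BLOCK DISTANCES**: `|p − q|₁ ≤ (n+1)·(|blk n p − blk n q|₁ + d)` (coordinatewise `p_i = (n+1)blk_i + r_i`,
`0 ≤ r_i ≤ n`). [folklore] -/
theorem l1_le_blockDist (n : ℕ) (p q : X d) :
    ∑ i, (((p i - q i).natAbs : ℕ) : ℝ) ≤ ((n : ℝ) + 1) * (∑ i, (((blk n p i - blk n q i).natAbs : ℕ) : ℝ) + d) := by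
  have hcoord : ∀ i, (((p i - q i).natAbs : ℕ) : ℝ) ≤ ((n : ℝ) + 1) * ((((blk n p i - blk n q i).natAbs : ℕ) : ℝ) + 1) := by
    intro i
    obtain ⟨-, hr0, hr1, hp⟩ := abs_le_side_mul n p i
    obtain ⟨-, hs0, hs1, hq⟩ := abs_le_side_mul n q i
    have hside : side n = (n : ℤ) + 1 := rfl
    rw [hside] at hr0 hs0 hr1 hs1 hp hq
    have e1 : p i - q i = ((n : ℤ) + 1) * (blk n p i - blk n q i) + (p i % side n - q i % side n) := by
      rw [hside]; linear_combination hp - hq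
    have h1 : |p i - q i| ≤ ((n : ℤ) + 1) * (|blk n p i - blk n q i| + 1) := by
      rw [e1]
      refine (abs_add_le _ _).trans ?_
      rw [abs_mul, abs_of_nonneg (by positivity : (0 : ℤ) ≤ (n : ℤ) + 1), mul_add, mul_one]
      have : |p i % side n - q i % side n| ≤ (n : ℤ) + 1 := by
        rw [hside, abs_le]; constructor <;> linarith
      linarith
    rw [← Int.natCast_natAbs, ← Int.natCast_natAbs] at h1
    exact_mod_cast h1
  calc ∑ i, (((p i - q i).natAbs : ℕ) : ℝ) ≤ ∑ i, ((n : ℝ) + 1) * ((((blk n p i - blk n q i).natAbs : ℕ) : ℝ) + 1) :=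
        Finset.sum_le_sum fun i _ => hcoord i
    _ = ((n : ℝ) + 1) * (∑ i, (((blk n p i - blk n q i).natAbs : ℕ) : ℝ) + d) := by
        rw [← Finset.mul_sum, Finset.sum_add_distrib]; simp

/-- **A BLOCK PROFILE IS A SITE PROFILE**: `|w(p)| ≤ Ae^{−μ|blk n p − b|₁}` (`μ ≥ 0`) ⟹ `|w(p)| ≤ Ae^{μd}·e^{−(μ∕(n+1))|p − p₀|₁}` with
`p₀ = chart n b 0` the corner of the block `b`. [folklore] -/
theorem siteProfile_of_blockProfile (n : ℕ) {μ A : ℝ} (hμ : 0 ≤ μ) (b : X d) (w : X d → ℝ)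
    (hw : ∀ p, |w p| ≤ A * exp (-(μ * ∑ i, (((blk n p i - b i).natAbs : ℕ) : ℝ)))) (p : X d) :
    |w p| ≤ A * exp (μ * d) * exp (-(μ / ((n : ℝ) + 1) * ∑ i, (((p i - chart n b 0 i).natAbs : ℕ) : ℝ))) := by
  have hA : 0 ≤ A := by
    have h := (abs_nonneg _).trans (hw p); exact le_of_mul_le_mul_right (by rw [zero_mul]; exact h) (exp_pos _)
  have hn : (0 : ℝ) < (n : ℝ) + 1 := by positivity
  have hl := l1_le_blockDist n p (chart n b 0)
  rw [blk_chart] at hl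
  refine (hw p).trans ?_
  rw [mul_assoc, ← exp_add]
  refine mul_le_mul_of_nonneg_left (exp_le_exp.2 ?_) hA
  have h1 : μ / ((n : ℝ) + 1) * ∑ i, (((p i - chart n b 0 i).natAbs : ℕ) : ℝ)
      ≤ μ * (∑ i, (((blk n p i - b i).natAbs : ℕ) : ℝ) + d) := by
    rw [div_mul_eq_mul_div, div_le_iff₀ hn]
    calc μ * ∑ i, (((p i - chart n b 0 i).natAbs : ℕ) : ℝ)
        ≤ μ * (((n : ℝ) + 1) * (∑ i, (((blk n p i - b i).natAbs : ℕ) : ℝ) + d)) := mul_le_mul_of_nonneg_left hl hμ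
      _ = _ := by ring
  linarith

/-- `|p − q|₁ ≤ d·dist(p,q)` for the sup metric of `ℤ^d`. [folklore] -/
theorem l1_le_dist (p q : X d) : ∑ i, (((p i - q i).natAbs : ℕ) : ℝ) ≤ d * dist p q := by
  have h : ∀ i, (((p i - q i).natAbs : ℕ) : ℝ) ≤ dist p q := fun i => by
    rw [Nat.cast_natAbs, Int.cast_abs, Int.cast_sub, ← Int.dist_eq]
    exact dist_le_pi_dist p q i
  calc ∑ i, (((p i - q i).natAbs : ℕ) : ℝ) ≤ ∑ _i : Fin d, dist p q := Finset.sum_le_sum fun i _ => h i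
    _ = d * dist p q := by simp

/-- **THE PERTURBED KERNEL DECAYS**: `|A(p,q) + V(p)δ_{pq} + K(p,q)| ≤ (c₀ + B_V + ε)·e^{−δ_T|p−q|₁}` with `δ_T = min(γ, (d+1)⁻¹)` —
`abs_AX_le` (`|A| ≤ c₀e^{−dist}`, `|p−q|₁ ≤ d·dist`), the diagonal, and `γ ≥ δ_T`. [folklore] -/
theorem perturbed_kernel_decay (n : ℕ) (a : ℝ) {BV ε γ : ℝ} (hε : 0 ≤ ε) (V : X d → ℝ) (hVb : ∀ p, |V p| ≤ BV)
    (K : X d → X d → ℝ) (hK : ∀ p q, |K p q| ≤ ε * exp (-(γ * ∑ i, (((p i - q i).natAbs : ℕ) : ℝ)))) (p q : X d) :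
    |AX n a p q + (if p = q then V p else 0) + K p q|
      ≤ (c0 d n a + BV + ε) * exp (-(min γ (1 / ((d : ℝ) + 1)) * ∑ i, (((p i - q i).natAbs : ℕ) : ℝ))) := by
  have hBV : 0 ≤ BV := (abs_nonneg _).trans (hVb p)
  have hc0 : 0 ≤ c0 d n a := by unfold c0; positivity
  have hS0 : (0 : ℝ) ≤ ∑ i, (((p i - q i).natAbs : ℕ) : ℝ) := by positivity
  have hδγ : min γ (1 / ((d : ℝ) + 1)) ≤ γ := min_le_left _ _
  have hd1 : (0 : ℝ) < (d : ℝ) + 1 := by positivity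
  -- the three pieces against the common profile
  set E : ℝ := exp (-(min γ (1 / ((d : ℝ) + 1)) * ∑ i, (((p i - q i).natAbs : ℕ) : ℝ))) with hE
  have hE0 : 0 ≤ E := (exp_pos _).le
  have h1 : |AX n a p q| ≤ c0 d n a * E := by
    refine (abs_AX_le n a p q).trans (mul_le_mul_of_nonneg_left (exp_le_exp.2 (neg_le_neg ?_)) hc0)
    have hl := l1_le_dist p q
    have hdist : 0 ≤ dist p q := dist_nonneg
    calc min γ (1 / ((d : ℝ) + 1)) * ∑ i, (((p i - q i).natAbs : ℕ) : ℝ) ≤ (1 / ((d : ℝ) + 1)) * (d * dist p q) :=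
          mul_le_mul (min_le_right _ _) hl hS0 (by positivity)
      _ ≤ 1 * dist p q := by
          rw [one_mul, div_mul_eq_mul_div, one_mul, div_le_iff₀ hd1]; nlinarith
  have h2 : |(if p = q then V p else 0)| ≤ BV * E := by
    split_ifs with hpq
    · subst hpq
      have : E = 1 := by rw [hE]; simp
      rw [this, mul_one]; exact hVb p
    · rw [abs_zero]; positivity
  have h3 : |K p q| ≤ ε * E :=
    (hK p q).trans (mul_le_mul_of_nonneg_left (exp_le_exp.2 (neg_le_neg (mul_le_mul_of_nonneg_right hδγ hS0))) hε)
  calc |AX n a p q + (if p = q then V p else 0) + K p q|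
      ≤ |AX n a p q| + |(if p = q then V p else 0)| + |K p q| := abs_add_three _ _ _
    _ ≤ c0 d n a * E + BV * E + ε * E := add_le_add (add_le_add h1 h2) h3
    _ = (c0 d n a + BV + ε) * E := by ring

/-- **THE ROW OF `A + Vδ + K` IS THE DISPLAYED ACTION**: for a bounded `w` and every `p`, `q ↦ (A(p,q) + V(p)δ_{pq} + K(p,q))w(q)` is summable and
`Σ′_q(A(p,q) + V(p)δ_{pq} + K(p,q))w(q) = (n+1)²Σ_μ(2w(p) − w(p+e_μ) − w(p−e_μ)) + a(n+1)^{−d}Σ_{q∈B(blk p)}w(q) + V(p)w(p) + Σ′_qK(p,q)w(q)` —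
(108′) `sum_nbhd_AX_mul`, the diagonal, (189) `summable_kernel_row`. [folklore] -/
theorem perturbed_row_eq (n : ℕ) (a : ℝ) {Bw ε γ : ℝ} (hγ : 0 < γ) (V : X d → ℝ) (K : X d → X d → ℝ)
    (hK : ∀ p q, |K p q| ≤ ε * exp (-(γ * ∑ i, (((p i - q i).natAbs : ℕ) : ℝ)))) (w : X d → ℝ) (hwb : ∀ p, |w p| ≤ Bw)
    (p : X d) :
    Summable (fun q => (AX n a p q + (if p = q then V p else 0) + K p q) * w q) ∧
    ∑' q, (AX n a p q + (if p = q then V p else 0) + K p q) * w q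
      = ((n : ℝ) + 1) ^ 2 * ∑ ν, (2 * w p - w (p + e ν) - w (p - e ν))
        + a / ((n : ℝ) + 1) ^ d * ∑ q ∈ B n (blk n p), w q + V p * w p + ∑' q : X d, K p q * w q := by
  classical
  have hsA : Summable fun q => AX n a p q * w q :=
    summable_of_ne_finset_zero (s := nbhd n p) fun q hq => by rw [AX_eq_zero_of_not_mem a hq, zero_mul]
  have hD0 : ∀ q, q ≠ p → (if p = q then V p else 0) * w q = 0 := fun q hq => by rw [if_neg (Ne.symm hq), zero_mul]
  have hsD : Summable fun q => (if p = q then V p else 0) * w q :=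
    summable_of_ne_finset_zero (s := {p}) fun q hq => hD0 q (fun h => hq (Finset.mem_singleton.2 h))
  have hsK : Summable fun q => K p q * w q := summable_kernel_row hγ K hK w hwb p
  have e : ∀ q, (AX n a p q + (if p = q then V p else 0) + K p q) * w q
      = AX n a p q * w q + (if p = q then V p else 0) * w q + K p q * w q := fun q => by ring
  refine ⟨((hsA.add hsD).add hsK).congr fun q => (e q).symm, ?_⟩
  rw [tsum_congr e, (hsA.add hsD).tsum_add hsK, hsA.tsum_add hsD, tsum_AX_mul, sum_nbhd_AX_mul,
    tsum_eq_single p hD0, if_pos rfl]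

/-- **THE FLOOR OF `H_V + K` FOR FUNCTIONS OF BLOCK PROFILE ON `ℤ^d`**: for every mesh `n`, coupling `a`, bounded potential `V ≥ −λ`, kernel
`|K(p,q)| ≤ εe^{−γ|p−q|₁}` (no symmetry) and every `w` with `|w(p)| ≤ Ae^{−μ|blk n p − b|₁}` (`μ > 0`): `Σ′w²` and `Σ′_pw(p)·((H_V + K)w)(p)` converge
(absolutely) and `(min(2,a) − λ − εK_γ)·Σ′_pw(p)² ≤ Σ′_pw(p)·((H_V + K)w)(p)` — §1 on the cubes and (233)'s `floor_of_decay`. [folklore] -/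
theorem perturbed_form_floor_profile (n : ℕ) (a : ℝ) {lam BV ε γ μ A : ℝ} (hε : 0 ≤ ε) (hγ : 0 < γ) (hμ : 0 < μ)
    (V : X d → ℝ) (hV : ∀ p, -lam ≤ V p) (hVb : ∀ p, |V p| ≤ BV)
    (K : X d → X d → ℝ) (hK : ∀ p q, |K p q| ≤ ε * exp (-(γ * ∑ i, (((p i - q i).natAbs : ℕ) : ℝ))))
    (b : X d) (w : X d → ℝ) (hw : ∀ p, |w p| ≤ A * exp (-(μ * ∑ i, (((blk n p i - b i).natAbs : ℕ) : ℝ)))) :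
    Summable (fun p => w p ^ 2) ∧
    Summable (fun p => w p * (((n : ℝ) + 1) ^ 2 * ∑ ν, (2 * w p - w (p + e ν) - w (p - e ν))
      + a / ((n : ℝ) + 1) ^ d * ∑ q ∈ B n (blk n p), w q + V p * w p + ∑' q : X d, K p q * w q)) ∧
    (min 2 a - lam - ε * (2 * (1 - exp (-γ))⁻¹) ^ d) * ∑' p, w p ^ 2
      ≤ ∑' p, w p * (((n : ℝ) + 1) ^ 2 * ∑ ν, (2 * w p - w (p + e ν) - w (p - e ν))
        + a / ((n : ℝ) + 1) ^ d * ∑ q ∈ B n (blk n p), w q + V p * w p + ∑' q : X d, K p q * w q) := by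
  classical
  have hA : 0 ≤ A := by
    have h := (abs_nonneg _).trans (hw 0); exact le_of_mul_le_mul_right (by rw [zero_mul]; exact h) (exp_pos _)
  have hwb : ∀ p, |w p| ≤ A := fun p =>
    (hw p).trans (mul_le_of_le_one_right hA (exp_le_one_iff.2 (neg_nonpos.2 (by positivity))))
  -- the one kernel `T = A + Vδ + K`
  obtain ⟨T, hT⟩ : ∃ T : X d → X d → ℝ, ∀ p q, T p q = AX n a p q + (if p = q then V p else 0) + K p q :=
    ⟨_, fun _ _ => rfl⟩
  have hTd : ∀ p q, |T p q| ≤ (c0 d n a + BV + ε) * exp (-(min γ (1 / ((d : ℝ) + 1)) * ∑ i, (((p i - q i).natAbs : ℕ) : ℝ))) :=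
    fun p q => by rw [hT]; exact perturbed_kernel_decay n a hε V hVb K hK p q
  have hδ : 0 < min γ (1 / ((d : ℝ) + 1)) := lt_min hγ (by positivity)
  have hfloor : ∀ (S : Finset (X d)) (g : X d → ℝ), (∀ q, q ∉ S → g q = 0) →
      (min 2 a - lam - ε * (2 * (1 - exp (-γ))⁻¹) ^ d) * ∑ q ∈ S, g q ^ 2 ≤ ∑ q ∈ S, g q * ∑ c ∈ S, T q c * g c := by
    intro S g _
    simp only [hT]
    exact perturbed_form_floor_finite n a hε hγ V hV K hK S g
  have hm := siteProfile_of_blockProfile n hμ.le b w hw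
  have hν : 0 < μ / ((n : ℝ) + 1) := by positivity
  obtain ⟨hsq, -, hs, hle⟩ := floor_of_decay hδ hν T hTd hfloor (chart n b 0) w hm
  have hrow : ∀ p, ∑' q, T p q * w q = ((n : ℝ) + 1) ^ 2 * ∑ ν, (2 * w p - w (p + e ν) - w (p - e ν))
      + a / ((n : ℝ) + 1) ^ d * ∑ q ∈ B n (blk n p), w q + V p * w p + ∑' q : X d, K p q * w q := fun p => by
    rw [tsum_congr fun q => by rw [hT]]
    exact (perturbed_row_eq n a hγ V K hK w hwb p).2
  simp only [hrow] at hs hle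
  exact ⟨hsq, hs, hle⟩

/-! ## §3. THE END: the fluctuation covariance of the `H + K` column is positive -/

/-- **HEADLINE — THE COVARIANCE FLOOR `⟨f, C_Kf⟩ ≥ γ_K‖C_Kf‖₂²`**: for every mesh `n`, coupling `a`, bounded potential `V ≥ −λ`, kernel
`|K(p,q)| ≤ εe^{−γ|p−q|₁}` (no symmetry), bounded source `f`, and ANY `w_f` (block profile at rate `μ` about `b_f`), `c_f` (coarse profile at rate
`ν ≤ μ`) with `Q′w_f = 0` and `(H_V + K)w_f = f − c_f∘blk` ((221)'s displays of `C_Kf`): `Σ′w_ff` and `Σ′w_f²` converge and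
`(min(2,a) − λ − εK_γ)·Σ′_pw_f(p)² ≤ Σ′_pw_f(p)f(p)` — §2's floor and (256) §1 (`Σ′w_f·c_f∘blk = 0`). [folklore] -/
theorem perturbed_covariance_floor (n : ℕ) (a : ℝ) {lam BV ε γ μ ν Af Cf Bf : ℝ} (hμ : 0 < μ) (hν : 0 < ν) (hνμ : ν ≤ μ)
    (hε : 0 ≤ ε) (hγ : 0 < γ) (V : X d → ℝ) (hV : ∀ p, -lam ≤ V p) (hVb : ∀ p, |V p| ≤ BV)
    (K : X d → X d → ℝ) (hK : ∀ p q, |K p q| ≤ ε * exp (-(γ * ∑ i, (((p i - q i).natAbs : ℕ) : ℝ))))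
    (bf : X d) (f wf cf : X d → ℝ) (hfB : ∀ p, |f p| ≤ Bf)
    (hwf : ∀ p, |wf p| ≤ Af * exp (-(μ * ∑ i, (((blk n p i - bf i).natAbs : ℕ) : ℝ))))
    (hcf : ∀ b, |cf b| ≤ Cf * exp (-(ν * ∑ i, (((b i - bf i).natAbs : ℕ) : ℝ))))
    (hQf : ∀ b, (((n : ℝ) + 1) ^ d)⁻¹ * ∑ q ∈ B n b, wf q = 0)
    (hHf : ∀ p, ((n : ℝ) + 1) ^ 2 * ∑ ν', (2 * wf p - wf (p + e ν') - wf (p - e ν'))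
      + a / ((n : ℝ) + 1) ^ d * ∑ q ∈ B n (blk n p), wf q + V p * wf p + ∑' q : X d, K p q * wf q = f p - cf (blk n p)) :
    Summable (fun p => wf p * f p) ∧ Summable (fun p => wf p ^ 2) ∧
    (min 2 a - lam - ε * (2 * (1 - exp (-γ))⁻¹) ^ d) * ∑' p, wf p ^ 2 ≤ ∑' p : X d, wf p * f p := by
  classical
  have hS0 : ∀ b c : X d, (0 : ℝ) ≤ ∑ i, (((b i - c i).natAbs : ℕ) : ℝ) := fun b c => by positivity
  have hAf : 0 ≤ Af := by
    have h := (abs_nonneg _).trans (hwf 0); exact le_of_mul_le_mul_right (by rw [zero_mul]; exact h) (exp_pos _)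
  have hwfν : ∀ p, |wf p| ≤ Af * exp (-(ν * ∑ i, (((blk n p i - bf i).natAbs : ℕ) : ℝ))) := fun p =>
    (hwf p).trans (mul_le_mul_of_nonneg_left (exp_le_exp.2 (neg_le_neg (mul_le_mul_of_nonneg_right hνμ (hS0 _ _)))) hAf)
  have swf : Summable wf := summable_of_blockProfile n hμ bf wf hwf
  have s1 : Summable fun p => wf p * f p := Summable.of_norm_bounded (swf.abs.mul_right Bf) fun p => by
    rw [Real.norm_eq_abs, abs_mul]; exact mul_le_mul_of_nonneg_left (hfB p) (abs_nonneg _)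
  obtain ⟨hsq, hs, hle⟩ := perturbed_form_floor_profile n a hε hγ hμ V hV hVb K hK bf wf hwf
  simp only [hHf] at hs hle
  obtain ⟨zs, z⟩ := fine_sum_blocks_zero n hν bf bf wf cf hwfν hcf hQf
  have e1 : ∑' p : X d, wf p * (f p - cf (blk n p)) = ∑' p : X d, wf p * f p - ∑' p : X d, wf p * cf (blk n p) := by
    rw [← s1.tsum_sub zs]; exact tsum_congr fun p => by ring
  rw [e1, z, sub_zero] at hle
  exact ⟨s1, hsq, hle⟩

/-- **THE COVARIANCE OF THE PERTURBED ROAD IS POSITIVE**: under the smallness `λ + εK_γ ≤ min(2,a)`, with everything as in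
`perturbed_covariance_floor`, `0 ≤ Σ′_p(C_Kf)(p)f(p) = ⟨f, C_Kf⟩`. [folklore] -/
theorem perturbed_covariance_nonneg (n : ℕ) (a : ℝ) {lam BV ε γ μ ν Af Cf Bf : ℝ} (hμ : 0 < μ) (hν : 0 < ν) (hνμ : ν ≤ μ)
    (hε : 0 ≤ ε) (hγ : 0 < γ) (hsmall : lam + ε * (2 * (1 - exp (-γ))⁻¹) ^ d ≤ min 2 a)
    (V : X d → ℝ) (hV : ∀ p, -lam ≤ V p) (hVb : ∀ p, |V p| ≤ BV)
    (K : X d → X d → ℝ) (hK : ∀ p q, |K p q| ≤ ε * exp (-(γ * ∑ i, (((p i - q i).natAbs : ℕ) : ℝ))))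
    (bf : X d) (f wf cf : X d → ℝ) (hfB : ∀ p, |f p| ≤ Bf)
    (hwf : ∀ p, |wf p| ≤ Af * exp (-(μ * ∑ i, (((blk n p i - bf i).natAbs : ℕ) : ℝ))))
    (hcf : ∀ b, |cf b| ≤ Cf * exp (-(ν * ∑ i, (((b i - bf i).natAbs : ℕ) : ℝ))))
    (hQf : ∀ b, (((n : ℝ) + 1) ^ d)⁻¹ * ∑ q ∈ B n b, wf q = 0)
    (hHf : ∀ p, ((n : ℝ) + 1) ^ 2 * ∑ ν', (2 * wf p - wf (p + e ν') - wf (p - e ν'))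
      + a / ((n : ℝ) + 1) ^ d * ∑ q ∈ B n (blk n p), wf q + V p * wf p + ∑' q : X d, K p q * wf q = f p - cf (blk n p)) :
    0 ≤ ∑' p : X d, wf p * f p := by
  obtain ⟨-, hsq, hle⟩ := perturbed_covariance_floor n a hμ hν hνμ hε hγ V hV hVb K hK bf f wf cf hfB hwf hcf hQf hHf
  have h0 : 0 ≤ (min 2 a - lam - ε * (2 * (1 - exp (-γ))⁻¹) ^ d) * ∑' p, wf p ^ 2 :=
    mul_nonneg (by linarith) (tsum_nonneg fun p => sq_nonneg _)
  exact h0.trans hle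

/-! ## §4. Toy -/

/-- Toy (`d = 1`, mesh `n = 0`, `a = 2`, `V = 0`, `K = 0`): with everything zero the positivity conclusion of §3 holds. -/
example : (0 : ℝ) ≤ ∑' p : X 1, (fun _ => (0 : ℝ)) p * (fun _ => (0 : ℝ)) p :=
  perturbed_covariance_nonneg (d := 1) 0 2 (lam := 0) (BV := 0) (ε := 0) (γ := 1) (μ := 1) (ν := 1) (Af := 0) (Cf := 0) (Bf := 0)
    one_pos one_pos le_rfl le_rfl one_pos (by norm_num) (fun _ => 0) (fun _ => by norm_num) (fun _ => by norm_num)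
    (fun _ _ => 0) (fun _ _ => by simp) 0 (fun _ => 0) (fun _ => 0) (fun _ => 0) (fun _ => by simp) (fun _ => by simp)
    (fun _ => by simp) (fun _ => by simp) (fun _ => by simp)

end Summit.QuantumFields.BalabanUV.T4Continuum.NE7b.SupZdPerturbedFormCoercive
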